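import Mathlib
import HarnessLib

/-!
# Lens 5 — Chart surjection lemmas (§13(c) plumbing)

Port of `Cruxes/DescentPerfectToAll/Lens5_ChartSurjection.lean` to Theorems. Author: lens-5 (g9).
Crux `stmt-ResolutionOfSingularities-0549` (`Theses.Descent.DescentPerfectToAll`). Counted 0; nothing here proves
resolution in char p; resolution in char p NOT proved. Def-free, Mathlib-only.

The chart map `κ_T[U]_𝔫 → S⧸𝔞` is SURJECTIVE and `𝔫` is MAXIMAL (generic lemmas). Customer = the T-slice port, memo
`CLASSBC-prank2-toric-lens5-g9.md` §13 (c): `S = locAtCentre A''.toSubring O`, `𝔞 = (u_{≤ρ})`, `Q = κ_T[U_{>ρ}]`,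
`F : Q → S⧸𝔞`, `𝔫 = F⁻¹(𝔪)`, and the claims (c1) `𝔫` is maximal, (c2) the induced `Q_𝔫 → S⧸𝔞` is surjective. Both
are typed here as GENERIC ring-theory lemmas whose remaining hypotheses are exactly the port's concrete facts:
* (c2) `lift_surjective_of_normal_form`: if every `s ∈ S` has a NORMAL FORM `s·c ≡ b (mod 𝔞)` with `b, c` in a set
  `R₀ ⊆ S`, `c̄` a unit of `S⧸𝔞`, and `F` hits `R₀ mod 𝔞`, then `IsLocalization.lift : Q_𝔫 → S⧸𝔞` is onto;
* (c1) `ker_isMaximal_of_isAlgebraic`: the kernel of an algebra map from `Q` to a FIELD algebraic over the ground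
  field `k` is maximal; and `comap_maximalIdeal_eq_ker_residue` identifying `F⁻¹(𝔪_E)` with that kernel.
-/

set_option linter.dupNamespace false

namespace Summit.ResolutionOfSingularities.ResolutionOfSingularities.Theorems.RadicialJungCleanModels.Lens5ChartSurjection

open IsLocalRing

/-- **(c2) Surjectivity of the chart map from a normal form.** `S` a ring, `𝔞` an ideal, `R₀ ⊆ S` a set such that every
`s` satisfies `s·c - b ∈ 𝔞` for some `b, c ∈ R₀` with `c` a unit mod `𝔞`; `F : Q → S⧸𝔞` a ring map whose range contains
`R₀ mod 𝔞`; `𝔫` a prime of `Q` such that `F` inverts `Q ∖ 𝔫` and every `q` with `F q` a unit lies outside `𝔫` (both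
hold for `𝔫 = F⁻¹(𝔪)` when `S⧸𝔞` is local); `P` the localisation of `Q` at `𝔫`. Then `IsLocalization.lift F : P → S⧸𝔞`
is surjective. OURS · CANDIDATE · counted 0. [folklore] -/
theorem lift_surjective_of_normal_form {S Q P : Type} [CommRing S] [CommRing Q] [CommRing P] [Algebra Q P]
    (𝔞 : Ideal S) (R₀ : Set S)
    (hloc : ∀ s : S, ∃ b c : S, b ∈ R₀ ∧ c ∈ R₀ ∧ IsUnit (Ideal.Quotient.mk 𝔞 c) ∧ s * c - b ∈ 𝔞)
    (F : Q →+* S ⧸ 𝔞) (hF : ∀ b ∈ R₀, Ideal.Quotient.mk 𝔞 b ∈ F.range)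
    (𝔫 : Ideal Q) [𝔫.IsPrime] [IsLocalization.AtPrime P 𝔫]
    (hunit : ∀ y : 𝔫.primeCompl, IsUnit (F y)) (h𝔫 : ∀ q : Q, IsUnit (F q) → q ∉ 𝔫) :
    Function.Surjective (IsLocalization.lift (S := P) hunit) := by
  intro t
  obtain ⟨s, rfl⟩ := Ideal.Quotient.mk_surjective t
  obtain ⟨b, c, hb, hc, hcu, hsc⟩ := hloc s
  obtain ⟨q₁, hq₁⟩ := hF b hb
  obtain ⟨q₂, hq₂⟩ := hF c hc
  have hq₂𝔫 : q₂ ∈ 𝔫.primeCompl := h𝔫 q₂ (hq₂ ▸ hcu)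
  refine ⟨IsLocalization.mk' P q₁ ⟨q₂, hq₂𝔫⟩, ?_⟩
  rw [IsLocalization.lift_mk'_spec]
  change F q₁ = F q₂ * Ideal.Quotient.mk 𝔞 s
  rw [hq₁, hq₂, ← map_mul, mul_comm]
  exact (Ideal.Quotient.eq.mpr hsc).symm

/-- The two side conditions of `lift_surjective_of_normal_form` for `𝔫 := F⁻¹(𝔪)` when the target is local.
OURS · CANDIDATE · counted 0. [folklore] -/
theorem primeCompl_comap_maximalIdeal {Q E : Type} [CommRing Q] [CommRing E] [IsLocalRing E] (F : Q →+* E) :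
    (∀ y : ((maximalIdeal E).comap F).primeCompl, IsUnit (F y)) ∧ (∀ q : Q, IsUnit (F q) → q ∉ (maximalIdeal E).comap F) := by
  refine ⟨fun y => ?_, fun q hq h => ?_⟩
  · have hy : F y ∉ maximalIdeal E := fun h => y.2 (Ideal.mem_comap.mpr h)
    exact (notMem_maximalIdeal.mp hy)
  · exact (notMem_maximalIdeal.mpr hq) (Ideal.mem_comap.mp h)

/-- **(c1) Maximality.** The kernel of a `k`-algebra map from a commutative `k`-algebra `Q` to a field `L` algebraic
over `k` is a maximal ideal (its range is a subalgebra of `L`, hence a field). OURS · CANDIDATE · counted 0. [folklore] -/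
theorem ker_isMaximal_of_isAlgebraic {k Q L : Type} [Field k] [CommRing Q] [Algebra k Q] [Field L] [Algebra k L]
    [Algebra.IsAlgebraic k L] (G : Q →ₐ[k] L) : (RingHom.ker (G : Q →+* L)).IsMaximal := by
  have hF : IsField G.range := Subalgebra.isField_of_algebraic G.range
  exact Ideal.Quotient.maximal_of_isField _ (MulEquiv.isField hF (Ideal.quotientKerEquivRange G).toMulEquiv)

/-- **(c1′) `F⁻¹(𝔪_E)` is the kernel of `Q → κ(E)`.** For a ring map `F : Q → E` into a local ring, the preimage of
the maximal ideal is the kernel of the composite with the residue map. OURS · CANDIDATE · counted 0. [folklore] -/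
theorem comap_maximalIdeal_eq_ker_residue {Q E : Type} [CommRing Q] [CommRing E] [IsLocalRing E] (F : Q →+* E) :
    (maximalIdeal E).comap F = RingHom.ker ((residue E).comp F) := by
  ext q
  rw [Ideal.mem_comap, RingHom.mem_ker, RingHom.comp_apply, residue_eq_zero_iff]

end Summit.ResolutionOfSingularities.ResolutionOfSingularities.Theorems.RadicialJungCleanModels.Lens5ChartSurjection
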